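import Mathlib
import Literature.MathematicalPhysics.QuantumFieldTheory.Balaban1983to89.TreeLength

/-!
# `Balaban1983to89.B16LargeFieldFactors380` — T. Bałaban, *Large field renormalization. II. Localization, exponentiation,
and bounds for the 𝐑 operation*, Commun. Math. Phys. **122** (1989) 355–392 [Balaban1989LargeFieldII], Sect. 1
pp. 380–381: *"the fundamental large field factors, which control convergence of the expansion of the effective
densities"* (SKELETON row **B16.Lem@380**, unnumbered) — the constants line of p. 380, the three displayed factors of
`χᶜ_j(P_j)`, `χ′ᶜ_j(Q_j)`, `χ^{(j−1)c}(R_j)` in the `p₀(g_j)`-dictionary, their per-component combination and the p. 381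
top display, PROVED as real arithmetic with every silent input an explicit hypothesis, and the count «a component made of
`n` cubes of linear size `d′` has `n ≧ d′ + 1`» PROVED in the tree's index model (`…TreeLength.treeLen_le_card_sub_one`)

statement-level skeleton of published theorems with citation tags; proofs where landed; nothing here is a claim about
the Yang–Mills mass gap

PDF held: `paper:balaban1989-cmp122-large-field-ii` (journal page = PDF page + 354); [III] = [Balaban1988Convergent],
[15] = [Balaban1985Variational], [16] = [Balaban1985UV3].  Every quotation below was READ AS AN IMAGE by this
seat on the x2 renders `run/shared/lean/pub/pub-balaban/b2b-balaban-ref1/pages/1989-cmp122-large-field-II/…-p026-x2.png`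
(p. 380) and `…-p027-x2.png` (p. 381).

CITATION HEADER / WHAT IS REPRODUCED (mega-formalization `lit-balaban`, reader/typer r13 gen 7; HOME
`run/shared/lean/pub/lit-balaban/`, rows `lit-balaban-r13/ROWS-B16.md` v2.21): SKELETON row **B16.Lem@380** (cell
«typed-existing (factor shapes)»: the factors enter the tree only as the abstract weights of `…B16Cor3Wilson` /
`Step.Budget`; none of the printed arithmetic of pp. 380–381 was kernel-checked).

WHAT IS PRINTED (pp. 380–381 [PDF 26–27], verbatim).  *"In effect we get a bound, to which every large field domain Z_j
contributes the constant O(1) log g_j⁻²|Z_j| ≦ O(1) log g_j⁻²(MR_j)^d d′_j(Z_j) ≦ O(1)M^dR_j^{d+1}d′_j(Z_j), where d′_j is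
the linear size defined in terms of MR_j-cubes instead of M-cubes. Next, we bound the Wilson action and the quadratic
forms, or rather the corresponding Gaussian integrals. We have to obtain all small factors connected with large fields.
Here the situation is almost exactly the same as in [16], so we summarize the results, and we discuss only some new
issues. Consider large field characteristic functions introduced in the j^{th} step. There is the function χᶜ_j(P_j),
which yields the factor exp(−γ₀(1/(2g_j²))(B₃⁻¹ε_j)²(LM₂R_j)^{−d}|P_j|) in the usual way, using Theorem 1 [15] and (71)
[16]. Here the volume is for the L^{−j}-scale, and γ₀ is an absolute positive constant (in this factor we may take γ₀ =
1/2). The function χ′ᶜ_j(Q_j) yields the factor exp(−½γ₀(1/g_j²)(2δ_j)²(LM₂R_j)^{−2}|Q_j|), by expanding the Wilson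
action locally in the approximate fluctuation field, and using the positivity bound for the resulting quadratic form.
The characteristic function χ^{(j−1)c}(R_j) yields the factor exp(−γ₀(1/g_j²)δ_j²(LM₂R_j)^{−d}|R_j|), by the same
positivity bound for the quadratic form. Take the cover of the large field region P_j∪Q_j∪R_j by MR_j-cubes, i.e., the
smallest domain containing this region, which is a union of MR_j-cubes. This domain is a union of components denoted by
Z_j^{(i)}, hence it is equal to ⋃_i Z_j^{(i)}. For each component the above large field factors yield an exponential
factor, which can be estimated by exp(−γ₀ min{½B₃⁻²A₀², 2A₁², A₁²}p₀²(g_j)(d′_j(Z_j^{(i)}) + 1)) ≦ exp(−½γ₀A₁²p₀²(g_j)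
(d′_j(Z_j^{(i)}) + 1) − 2p₀(g_j)). These are the fundamental large field factors, which control convergence of the
expansion of the effective densities."*

WHAT IS HERE (every `theorem` PROVED; the silent inputs are explicit hypotheses named as printed or as in the cell's
constants ledger `lit-balaban/GAPS.md` G-B16-07).
* §1 `vacuumLine380` — the constants line with the count made explicit: `|Z_j| ≦ (MR_j)^d·n` (`n` = the number of
  MR_j-cubes of `Z_j`), `n ≦ K(d′_j + 1)` (the lower half of [Balaban1988RG2Cluster] (2.30) in the repaired `+1` form the
  tree proves as `…TreeLength` Part 5 — the print's bare `d′_j(Z_j)` fails for a single cube, `d′ = 0`: cell transcript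
  note D-b02.7), `log g_j⁻² ≦ R_j` ([III] (2.5), `r₀ ≧ 1`): then `O(1) log g_j⁻²|Z_j| ≦ (O(1)K)M^dR_j^{d+1}(d′_j + 1)`.
* §2 the three exponents (`expP`, `expQ`, `expR`, transcribed with the printed powers — the `(LM₂R_j)^{−2}` of the
  `Q_j`-factor SIC, print slip for `−d`, cell D-b02.7; both are mere normalisations of the cube counts `nP`, `nQ`, `nR`
  here) in the `p₀(g_j)`-dictionary `ε_j = g_jA₀p₀(g_j)`, `δ_j = g_jA₁p₀(g_j)` ([III] (2.2)–(2.4) in the convention of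
  `…B16Sect1Statements` §12): `expP = γ₀·½B₃⁻²A₀²·p₀²·nP`, `expQ = γ₀·2A₁²·p₀²·nQ`, `expR = γ₀·A₁²·p₀²·nR` — which is where
  the printed `min{½B₃⁻²A₀², 2A₁², A₁²}` comes from (`expP_eq`, `expQ_eq`, `expR_eq`).
* §3 the per-component combination: `sum_exp_ge_min` — `expP + expQ + expR ≧ γ₀ min{½B₃⁻²A₀², 2A₁², A₁²}p₀²(nP + nQ + nR)`;
  `componentFactor_le` — with `nP + nQ + nR ≧ d′ + 1` (`hcount`, §5) the product of the three factors is
  `≦ exp(−γ₀ min{…}p₀²(g_j)(d′ + 1))`, the left member of the p. 381 display.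
* §4 `display381` — the p. 381 display itself, `exp(−γ₀ min{…}p₀²(d′ + 1)) ≦ exp(−½γ₀A₁²p₀²(d′ + 1) − 2p₀(g_j))`, from
  `2B₃²A₁² ≦ A₀²` (so `min{…} = A₁²`; implied by ledger R2 `A₀² ≧ 8B₃²(1 + β₀)²A₁²`) and the smallness of `g_j` in the
  explicit form `4 ≦ γ₀A₁²p₀(g_j)` (`p₀(g_j) → ∞`); `min_eq_A1sq` records `min{…} = A₁²` under `2B₃²A₁² ≦ A₀²`.
* §5 the count, in the ℤ^d index model of `…B13ScaleTransfer`/`…TreeLength` (reading: `d′_j(Z_j^{(i)})` = `treeLen` of the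
  index set `S` of the MR_j-cubes of the component, the linear size of [Balaban1987RG1] p. 257 *"defined in terms of
  MR_j-cubes instead of M-cubes"*; components face-connected): `treeLen_add_one_le_card` (`d′ + 1 ≦ #S`, =
  `TreeLength.treeLen_le_card_sub_one`) and `hcount_of_cover` (every cube of the cover carries at least one
  `LM₂R_j`-cube of `P_j ∪ Q_j ∪ R_j` — `hcover : #S ≦ nP + nQ + nR`, the covering sentence — hence `hcount`).
* §6 `fundamentalFactor_le` — §§2–5 assembled: for a face-connected component, the product of the three printed factors is
  at most the right member of the p. 381 display.
NOT HERE (leaves, as before): that the characteristic functions DO yield the three factors (Theorem 1 [15] + (71) [16],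
the local expansion of the Wilson action and the positivity bound — rows B11.Thm1, B10.Eq71, B16.Eq1.7), and the choice
`γ₀ = 1/2`.  No `sorry`, no axiom; nothing printed is asserted as a fact.
-/

namespace Literature.MathematicalPhysics.QuantumFieldTheory.Balaban1983to89.B16LargeFieldFactors380

/-! ## §1. p. 380: the constant contributed by a large field domain `Z_j` -/

/-- **p. 380 [26], the constants line** (render p026), verbatim: *"In effect we get a bound, to which every large field
domain Z_j contributes the constant O(1) log g_j⁻²|Z_j| ≦ O(1) log g_j⁻²(MR_j)^d d′_j(Z_j) ≦ O(1)M^dR_j^{d+1}d′_j(Z_j),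
where d′_j is the linear size defined in terms of MR_j-cubes instead of M-cubes."* — PROVED with the count explicit and
the `+1` reading (cell D-b02.7): `ℓ = log g_j⁻²`, `volZ = |Z_j|`, `n` = the number of MR_j-cubes of `Z_j` (`hvol :
volZ ≦ (MR_j)^d n`), `hn : n ≦ K(d′ + 1)` (repaired lower half of (2.30) [Balaban1988RG2Cluster]), `hℓ : ℓ ≦ R_j`
([III] (2.5) with `r₀ ≧ 1`), `C` = the printed `O(1)`. [cite: Balaban1989LargeFieldII, p.380 (before (1.76))] -/
theorem vacuumLine380 {C K ℓ volZ n M Rj d' : ℝ} {d : ℕ} (hC : 0 ≤ C) (hK : 0 ≤ K) (hℓ0 : 0 ≤ ℓ) (hM : 0 ≤ M)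
    (hRj : 0 ≤ Rj) (hd' : 0 ≤ d') (hvol : volZ ≤ (M * Rj) ^ d * n) (hn : n ≤ K * (d' + 1)) (hℓ : ℓ ≤ Rj) :
    C * ℓ * volZ ≤ C * ℓ * (M * Rj) ^ d * (K * (d' + 1)) ∧
      C * ℓ * (M * Rj) ^ d * (K * (d' + 1)) ≤ C * K * M ^ d * Rj ^ (d + 1) * (d' + 1) := by
  have hMR : 0 ≤ (M * Rj) ^ d := pow_nonneg (mul_nonneg hM hRj) d
  have hCℓ : 0 ≤ C * ℓ := mul_nonneg hC hℓ0
  refine ⟨?_, ?_⟩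
  · calc C * ℓ * volZ ≤ C * ℓ * ((M * Rj) ^ d * n) := mul_le_mul_of_nonneg_left hvol hCℓ
      _ ≤ C * ℓ * ((M * Rj) ^ d * (K * (d' + 1))) :=
          mul_le_mul_of_nonneg_left (mul_le_mul_of_nonneg_left hn hMR) hCℓ
      _ = _ := by ring
  · have h1 : C * ℓ * (M * Rj) ^ d * (K * (d' + 1)) = (C * K * M ^ d * Rj ^ d * (d' + 1)) * ℓ := by
      rw [mul_pow]; ring
    have h2 : C * K * M ^ d * Rj ^ (d + 1) * (d' + 1) = (C * K * M ^ d * Rj ^ d * (d' + 1)) * Rj := by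
      rw [pow_succ]; ring
    rw [h1, h2]
    exact mul_le_mul_of_nonneg_left hℓ (by positivity)

/-! ## §2. pp. 380: the three large-field factors in the `p₀(g_j)`-dictionary -/

/-- The exponent of the `χᶜ_j(P_j)`-factor, p. 380 verbatim: *"exp(−γ₀(1/(2g_j²))(B₃⁻¹ε_j)²(LM₂R_j)^{−d}|P_j|) … Here the
volume is for the L^{−j}-scale"* (`LM2R` = `LM₂R_j`, `volP` = `|P_j|`). [cite: Balaban1989LargeFieldII, p.380 (before (1.76))] -/
noncomputable def expP (γ₀ gj B₃ εj LM2R : ℝ) (d : ℕ) (volP : ℝ) : ℝ :=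
  γ₀ * (1 / (2 * gj ^ 2)) * (B₃⁻¹ * εj) ^ 2 * (LM2R ^ d)⁻¹ * volP

/-- The exponent of the `χ′ᶜ_j(Q_j)`-factor, p. 380 verbatim: *"exp(−½γ₀(1/g_j²)(2δ_j)²(LM₂R_j)^{−2}|Q_j|)"* — the power
`−2` transcribed AS PRINTED (sic; `−d` is meant, cell D-b02.7; here it only fixes the normalisation of the count `nQ`).
[cite: Balaban1989LargeFieldII, p.380 (before (1.76))] -/
noncomputable def expQ (γ₀ gj δj LM2R volQ : ℝ) : ℝ :=
  1 / 2 * γ₀ * (1 / gj ^ 2) * (2 * δj) ^ 2 * (LM2R ^ 2)⁻¹ * volQ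

/-- The exponent of the `χ^{(j−1)c}(R_j)`-factor, p. 380 verbatim: *"exp(−γ₀(1/g_j²)δ_j²(LM₂R_j)^{−d}|R_j|)"*.
[cite: Balaban1989LargeFieldII, p.380 (before (1.76))] -/
noncomputable def expR (γ₀ gj δj LM2R : ℝ) (d : ℕ) (volR : ℝ) : ℝ :=
  γ₀ * (1 / gj ^ 2) * δj ^ 2 * (LM2R ^ d)⁻¹ * volR

/-- The printed minimum `min{½B₃⁻²A₀², 2A₁², A₁²}` of p. 381. [cite: Balaban1989LargeFieldII, p.381 (before (1.76))] -/
noncomputable def minConst (B₃ A₀ A₁ : ℝ) : ℝ := min (min (1 / 2 * (B₃ ^ 2)⁻¹ * A₀ ^ 2) (2 * A₁ ^ 2)) (A₁ ^ 2)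

/-- `P_j`-factor in the dictionary `ε_j = g_jA₀p₀(g_j)` ([III] (2.2)): its exponent is `γ₀·½B₃⁻²A₀²·p₀²(g_j)·nP` with
`nP = (LM₂R_j)^{−d}|P_j|` the number of `LM₂R_j`-cubes of `P_j` — the first entry of the printed minimum. PROVED.
[cite: Balaban1989LargeFieldII, p.381 (before (1.76))] -/
theorem expP_eq {γ₀ gj B₃ εj LM2R volP A₀ p₀g : ℝ} {d : ℕ} (hgj : gj ≠ 0) (hε : εj = gj * A₀ * p₀g) :
    expP γ₀ gj B₃ εj LM2R d volP = γ₀ * (1 / 2 * (B₃ ^ 2)⁻¹ * A₀ ^ 2) * p₀g ^ 2 * ((LM2R ^ d)⁻¹ * volP) := by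
  unfold expP; subst hε; field_simp

/-- `Q_j`-factor in the dictionary `δ_j = g_jA₁p₀(g_j)` ([III] (2.3)): exponent `γ₀·2A₁²·p₀²(g_j)·nQ`, `nQ =
(LM₂R_j)^{−2}|Q_j|` — the second entry of the minimum. PROVED. [cite: Balaban1989LargeFieldII, p.381 (before (1.76))] -/
theorem expQ_eq {γ₀ gj δj LM2R volQ A₁ p₀g : ℝ} (hgj : gj ≠ 0) (hδ : δj = gj * A₁ * p₀g) :
    expQ γ₀ gj δj LM2R volQ = γ₀ * (2 * A₁ ^ 2) * p₀g ^ 2 * ((LM2R ^ 2)⁻¹ * volQ) := by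
  unfold expQ; subst hδ; field_simp

/-- `R_j`-factor in the same dictionary: exponent `γ₀·A₁²·p₀²(g_j)·nR`, `nR = (LM₂R_j)^{−d}|R_j|` — the third entry.
PROVED. [cite: Balaban1989LargeFieldII, p.381 (before (1.76))] -/
theorem expR_eq {γ₀ gj δj LM2R volR A₁ p₀g : ℝ} {d : ℕ} (hgj : gj ≠ 0) (hδ : δj = gj * A₁ * p₀g) :
    expR γ₀ gj δj LM2R d volR = γ₀ * A₁ ^ 2 * p₀g ^ 2 * ((LM2R ^ d)⁻¹ * volR) := by
  unfold expR; subst hδ; field_simp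

/-! ## §3. p. 381: the per-component combination -/

/-- The three exponents together dominate `γ₀ min{½B₃⁻²A₀², 2A₁², A₁²}p₀²(g_j)` times the total cube count
`nP + nQ + nR` (each count weighted by its own constant is at least the minimum times the count). PROVED.
[cite: Balaban1989LargeFieldII, p.381 (before (1.76))] -/
theorem sum_exp_ge_min {γ₀ B₃ A₀ A₁ p₀g nP nQ nR : ℝ} (hγ : 0 ≤ γ₀) (hP : 0 ≤ nP) (hQ : 0 ≤ nQ) (hR : 0 ≤ nR) :
    γ₀ * minConst B₃ A₀ A₁ * p₀g ^ 2 * (nP + nQ + nR) ≤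
      γ₀ * (1 / 2 * (B₃ ^ 2)⁻¹ * A₀ ^ 2) * p₀g ^ 2 * nP + γ₀ * (2 * A₁ ^ 2) * p₀g ^ 2 * nQ +
        γ₀ * A₁ ^ 2 * p₀g ^ 2 * nR := by
  have hm1 : minConst B₃ A₀ A₁ ≤ 1 / 2 * (B₃ ^ 2)⁻¹ * A₀ ^ 2 := (min_le_left _ _).trans (min_le_left _ _)
  have hm2 : minConst B₃ A₀ A₁ ≤ 2 * A₁ ^ 2 := (min_le_left _ _).trans (min_le_right _ _)
  have hm3 : minConst B₃ A₀ A₁ ≤ A₁ ^ 2 := min_le_right _ _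
  have hw : 0 ≤ γ₀ * p₀g ^ 2 := mul_nonneg hγ (sq_nonneg _)
  have e : γ₀ * minConst B₃ A₀ A₁ * p₀g ^ 2 * (nP + nQ + nR) =
      γ₀ * p₀g ^ 2 * (minConst B₃ A₀ A₁ * nP) + γ₀ * p₀g ^ 2 * (minConst B₃ A₀ A₁ * nQ) +
        γ₀ * p₀g ^ 2 * (minConst B₃ A₀ A₁ * nR) := by ring
  rw [e]
  have h1 := mul_le_mul_of_nonneg_left (mul_le_mul_of_nonneg_right hm1 hP) hw
  have h2 := mul_le_mul_of_nonneg_left (mul_le_mul_of_nonneg_right hm2 hQ) hw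
  have h3 := mul_le_mul_of_nonneg_left (mul_le_mul_of_nonneg_right hm3 hR) hw
  nlinarith [h1, h2, h3]

/-- **p. 381 [27], left member** (render p027): *"For each component the above large field factors yield an exponential
factor, which can be estimated by exp(−γ₀ min{½B₃⁻²A₀², 2A₁², A₁²}p₀²(g_j)(d′_j(Z_j^{(i)}) + 1))"* — PROVED: the product
of the three printed factors restricted to the component (cube counts `nP`, `nQ`, `nR` of `P_j`, `Q_j`, `R_j` inside
`Z_j^{(i)}`) is at most that, given the dictionary (`hε`, `hδ`) and the count `hcount : d′ + 1 ≦ nP + nQ + nR` (§5).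
[cite: Balaban1989LargeFieldII, p.381 (before (1.76))] -/
theorem componentFactor_le {γ₀ gj B₃ εj δj LM2R volP volQ volR A₀ A₁ p₀g d' : ℝ} {d : ℕ} (hgj : gj ≠ 0)
    (hγ : 0 ≤ γ₀) (hε : εj = gj * A₀ * p₀g) (hδ : δj = gj * A₁ * p₀g)
    (hP : 0 ≤ (LM2R ^ d)⁻¹ * volP) (hQ : 0 ≤ (LM2R ^ 2)⁻¹ * volQ) (hR : 0 ≤ (LM2R ^ d)⁻¹ * volR)
    (hcount : d' + 1 ≤ (LM2R ^ d)⁻¹ * volP + (LM2R ^ 2)⁻¹ * volQ + (LM2R ^ d)⁻¹ * volR) :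
    Real.exp (-expP γ₀ gj B₃ εj LM2R d volP) * Real.exp (-expQ γ₀ gj δj LM2R volQ) *
        Real.exp (-expR γ₀ gj δj LM2R d volR) ≤
      Real.exp (-(γ₀ * minConst B₃ A₀ A₁ * p₀g ^ 2 * (d' + 1))) := by
  rw [← Real.exp_add, ← Real.exp_add, Real.exp_le_exp, expP_eq hgj hε, expQ_eq hgj hδ, expR_eq hgj hδ]
  have hmin : 0 ≤ γ₀ * minConst B₃ A₀ A₁ * p₀g ^ 2 := by
    have : 0 ≤ minConst B₃ A₀ A₁ :=
      le_min (le_min (by positivity) (by positivity)) (sq_nonneg _)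
    positivity
  have hstep := mul_le_mul_of_nonneg_left hcount hmin
  have hsum := sum_exp_ge_min (B₃ := B₃) (A₀ := A₀) (A₁ := A₁) (p₀g := p₀g) hγ hP hQ hR
  linarith

/-! ## §4. p. 381: the displayed comparison -/

/-- Under `2B₃²A₁² ≦ A₀²` (implied by the constants-ledger relation R2 `A₀² ≧ 8B₃²(1 + β₀)²A₁²` of GAPS G-B16-07) the
printed minimum IS its last entry: `min{½B₃⁻²A₀², 2A₁², A₁²} = A₁²`. PROVED. [cite: Balaban1989LargeFieldII, p.381 (before (1.76))] -/
theorem min_eq_A1sq {B₃ A₀ A₁ : ℝ} (hB₃ : B₃ ≠ 0) (hR2 : 2 * B₃ ^ 2 * A₁ ^ 2 ≤ A₀ ^ 2) :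
    minConst B₃ A₀ A₁ = A₁ ^ 2 := by
  have hB2 : 0 < B₃ ^ 2 := by positivity
  have h1 : A₁ ^ 2 ≤ 1 / 2 * (B₃ ^ 2)⁻¹ * A₀ ^ 2 := by
    rw [show 1 / 2 * (B₃ ^ 2)⁻¹ * A₀ ^ 2 = A₀ ^ 2 / (2 * B₃ ^ 2) by field_simp]
    rw [le_div_iff₀ (by positivity)]
    linarith
  have h2 : A₁ ^ 2 ≤ 2 * A₁ ^ 2 := by nlinarith [sq_nonneg A₁]
  unfold minConst
  exact min_eq_right (le_min h1 h2)

/-- **p. 381 [27], the display** (render p027), verbatim: *"exp(−γ₀ min{½B₃⁻²A₀², 2A₁², A₁²}p₀²(g_j)(d′_j(Z_j^{(i)}) + 1))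
≦ exp(−½γ₀A₁²p₀²(g_j)(d′_j(Z_j^{(i)}) + 1) − 2p₀(g_j))"* — PROVED from the inputs the text uses silently: `2B₃²A₁² ≦ A₀²`
(ledger R2, so the minimum is `A₁²`), `d′ ≧ 0`, `p₀(g_j) ≧ 0`, and the smallness of `g_j` in the explicit form
`4 ≦ γ₀A₁²p₀(g_j)` (then `½γ₀A₁²p₀²(g_j)·1 ≧ 2p₀(g_j)` pays for the last term). [cite: Balaban1989LargeFieldII, p.381 (before (1.76))] -/
theorem display381 {γ₀ B₃ A₀ A₁ p₀g d' : ℝ} (hB₃ : B₃ ≠ 0) (hγ : 0 ≤ γ₀) (hp : 0 ≤ p₀g) (hd' : 0 ≤ d')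
    (hR2 : 2 * B₃ ^ 2 * A₁ ^ 2 ≤ A₀ ^ 2) (hsmall : 4 ≤ γ₀ * A₁ ^ 2 * p₀g) :
    Real.exp (-(γ₀ * minConst B₃ A₀ A₁ * p₀g ^ 2 * (d' + 1))) ≤
      Real.exp (-(1 / 2 * γ₀ * A₁ ^ 2 * p₀g ^ 2 * (d' + 1)) - 2 * p₀g) := by
  rw [min_eq_A1sq hB₃ hR2, Real.exp_le_exp]
  -- `γ₀A₁²p₀²(d′+1) = ½γ₀A₁²p₀²(d′+1) + ½γ₀A₁²p₀²(d′+1)` and `½γ₀A₁²p₀²(d′+1) ≥ ½γ₀A₁²p₀² ≥ 2p₀`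
  have h1 : 2 * p₀g ≤ 1 / 2 * γ₀ * A₁ ^ 2 * p₀g ^ 2 := by nlinarith [mul_le_mul_of_nonneg_right hsmall hp]
  have h2 : 1 / 2 * γ₀ * A₁ ^ 2 * p₀g ^ 2 ≤ 1 / 2 * γ₀ * A₁ ^ 2 * p₀g ^ 2 * (d' + 1) := by
    have h0 : 0 ≤ 1 / 2 * γ₀ * A₁ ^ 2 * p₀g ^ 2 := by positivity
    nlinarith
  nlinarith

/-! ## §5. The count: a component made of `n` cubes has `n ≧ d′ + 1` -/

open B13ScaleTransfer TreeLength

/-- In the ℤ^d index model (`d′` = the linear size `TreeLength.treeLen` of the index set `S` of the MR_j-cubes of the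
component, [Balaban1987RG1] p. 257 *"defined in terms of MR_j-cubes instead of M-cubes"*; face-connected components): a
face-connected union of `#S` cubes has `d′ + 1 ≦ #S` — the tree's `TreeLength.treeLen_le_card_sub_one` (the upper half of
[Balaban1988RG2Cluster] (2.30)). PROVED. [cite: Balaban1989LargeFieldII, p.381 (before (1.76))] -/
theorem treeLen_add_one_le_card {d : ℕ} {S : Finset (Pt d)} (hS : S.Nonempty) (hc : FaceConnected S) :
    treeLen S + 1 ≤ (S.card : ℝ) := by
  have := treeLen_le_card_sub_one hS hc
  linarith

/-- The count `hcount` of `componentFactor_le` from the covering sentence of p. 380 — *"Take the cover of the large field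
region P_j∪Q_j∪R_j by MR_j-cubes, i.e., the smallest domain containing this region, which is a union of MR_j-cubes"*:
every MR_j-cube of the cover meets the region, so it carries at least one of the counted `LM₂R_j`-cubes of
`P_j ∪ Q_j ∪ R_j` (`hcover : #S ≦ nP + nQ + nR`, the reading in which the cube count of the component is paid for by the
counts of the three factors) — and `treeLen_add_one_le_card`. PROVED. [cite: Balaban1989LargeFieldII, p.380 (before (1.76))] -/
theorem hcount_of_cover {d : ℕ} {S : Finset (Pt d)} (hS : S.Nonempty) (hc : FaceConnected S) {nP nQ nR : ℝ}
    (hcover : (S.card : ℝ) ≤ nP + nQ + nR) : treeLen S + 1 ≤ nP + nQ + nR :=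
  (treeLen_add_one_le_card hS hc).trans hcover

/-! ## §6. Assembled: the fundamental large-field factor of one component -/

/-- **pp. 380–381, the fundamental large field factor of a component `Z_j^{(i)}`**, assembled from §§2–5: for a
face-connected component whose MR_j-cubes are indexed by `S` (`d′ = treeLen S`), whose cube count is paid for by the
cube counts of the three factors (`hcover`), in the dictionary `ε_j = g_jA₀p₀(g_j)`, `δ_j = g_jA₁p₀(g_j)`, under the ledger
relation `2B₃²A₁² ≦ A₀²` and `g_j` small (`4 ≦ γ₀A₁²p₀(g_j)`), the product of the three printed factors is
`≦ exp(−½γ₀A₁²p₀²(g_j)(d′_j(Z_j^{(i)}) + 1) − 2p₀(g_j))` — *"These are the fundamental large field factors"*. PROVED.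
[cite: Balaban1989LargeFieldII, p.381 (before (1.76))] -/
theorem fundamentalFactor_le {dd : ℕ} {S : Finset (Pt dd)} (hS : S.Nonempty) (hc : FaceConnected S)
    {γ₀ gj B₃ εj δj LM2R volP volQ volR A₀ A₁ p₀g : ℝ} {d : ℕ} (hgj : gj ≠ 0) (hB₃ : B₃ ≠ 0) (hγ : 0 ≤ γ₀)
    (hp : 0 ≤ p₀g) (hε : εj = gj * A₀ * p₀g) (hδ : δj = gj * A₁ * p₀g)
    (hP : 0 ≤ (LM2R ^ d)⁻¹ * volP) (hQ : 0 ≤ (LM2R ^ 2)⁻¹ * volQ) (hR : 0 ≤ (LM2R ^ d)⁻¹ * volR)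
    (hcover : (S.card : ℝ) ≤ (LM2R ^ d)⁻¹ * volP + (LM2R ^ 2)⁻¹ * volQ + (LM2R ^ d)⁻¹ * volR)
    (hR2 : 2 * B₃ ^ 2 * A₁ ^ 2 ≤ A₀ ^ 2) (hsmall : 4 ≤ γ₀ * A₁ ^ 2 * p₀g) :
    Real.exp (-expP γ₀ gj B₃ εj LM2R d volP) * Real.exp (-expQ γ₀ gj δj LM2R volQ) *
        Real.exp (-expR γ₀ gj δj LM2R d volR) ≤
      Real.exp (-(1 / 2 * γ₀ * A₁ ^ 2 * p₀g ^ 2 * (treeLen S + 1)) - 2 * p₀g) :=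
  (componentFactor_le hgj hγ hε hδ hP hQ hR (hcount_of_cover hS hc hcover)).trans
    (display381 hB₃ hγ hp (treeLen_nonneg S) hR2 hsmall)

end Literature.MathematicalPhysics.QuantumFieldTheory.Balaban1983to89.B16LargeFieldFactors380
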